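import Summits.HodgeConjecture.CorCM.GaloisTwentyFourC3SemidirectC8Degenerate
import HarnessLib

/-!
# Order-32 census row #40 (`⟨a, b | a⁴, b⁴, [a,b] central⟩`) is BAD for every complex conjugation

COR-CM (cell `pub-hodgecm2`), binder seat b04 (gen 28), count-neutral — closes the «computed-only» rows #40 and #41 of gen
23's ORDER-32 CENSUS. Row #40 = `⟨a, b | a⁴ = b⁴ = 1, [a, b] = z, z² = 1, z central⟩` (all `7` involutions central; model
`ℤ/4 × ℤ/4 × ℤ/2`, law `(i,j,k)(i′,j′,k′) = (i+i′, j+j′, k+k′+j i′)`); row #41 = `Q₈ ⋊ C₄` with `t` acting on `Q₈` by the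
OUTER involution `i ↔ j` (model `𝔽₂³ × ℤ/4`, `(a,b,c,d) ↔ iᵃ jᵇ (−1)ᶜ tᵈ`; identifications by isomorphism test against the
census tables, `scratch-g28/ident28.py`, `ident41.py`). For each of the `7 + 3` central involutions a certificate `(T₀, D)`
(PRIMITIVE CM set, balanced set of size `4` or `8`; random search + exhaustive small `D`, `scratch-g28/o32cert.py`) is
checked by `decide` through gen 20's `GaloisModels.exists_simple_degenerate_of_table_balanced`: **both groups are BAD for
every complex conjugation**. Together with the companion file (rows #28/#29) and gen 27 (rows #11, #35, #43–#45): the gen-23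
census of the 51 groups of order 32 is now a set of tree theorems in EVERY row — GOOD exactly for `C₃₂`, `C₁₆ × C₂` (`c ∈
C₁₆`), `Q₃₂`, `Q₁₆ × C₂` (`c ∈ Q₁₆`). KERNEL ONLY: theorems; no definition, no named fact, no `sorry`. `HC_CM` is neither
used nor claimed.

## References

* [Shimura1998] G. Shimura, *Abelian Varieties with Complex Multiplication and Modular Functions*, §6.2 Thm. 3, §8.2 Prop. 26.
* [Gordon1999HodgeAVSurvey] B. B. Gordon, *A survey of the Hodge conjecture for abelian varieties*, Thm. 6.4, §9.3.
-/

noncomputable section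

open CategoryTheory CategoryTheory.Limits NumberField
open scoped BigOperators

namespace Summit.HodgeConjecture.CorCM.GaloisModels

open Literature.NumberTheory.ComplexMultiplication
open Literature.AlgebraicGeometry.Motives (AbelianVariety CMType)
open Literature.AlgebraicGeometry.HodgeTheory
open Literature.AlgebraicGeometry.ComplexMultiplication (IsCMTypeRealisation)
open Literature.AlgebraicGeometry.Pohlmann1968
open Literature.Barriers.HodgeConjecture (divisorClassesSpan)

variable {K : Type} [Field K] [NumberField K] [IsCMField K] [IsGalois ℚ K]

/-- **CERTIFICATE FORMAT for `Gal(K/ℚ) ≅`** `⟨a, b | a⁴ = b⁴ = 1, [a,b] = z central, z² = 1⟩` (order-32 census row #40; `|Z| = 8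
= ⟨a², b², z⟩`, `G′ = ⟨z⟩`, exponent `4`, all `7` involutions central); model `X = ℤ/4 × ℤ/4 × ℤ/2`, `(i,j,k) ↔ aⁱ bʲ zᵏ`,
law `(i,j,k)(i′,j′,k′) = (i+i′, j+j′, k+k′+j·i′)`: a CM set `T₀` for the prescribed complex conjugation `c₀` with trivial
left stabiliser and a balanced `D` with `c₀D ≠ D` give a simple DEGENERATE CM abelian `16`-fold with a `(q,q)` class outside
the divisor ring on a power. [cite: Shimura1998, §6.2 Thm. 3 and §8.2 Prop. 26] [cite: Gordon1999HodgeAVSurvey, Thm. 6.4 and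
§9.3] -/
theorem exists_simple_degenerate_of_c4c4z_balanced (e : (K ≃ₐ[ℚ] K) ≃ ZMod 4 × ZMod 4 × ZMod 2)
    (hmul : ∀ a b : K ≃ₐ[ℚ] K, e (a * b) =
      ((e a).1 + (e b).1,
      (e a).2.1 + (e b).2.1,
      (e a).2.2 + (e b).2.2 + (((e a).2.1.val * (e b).1.val : ℕ) : ZMod 2)))
    (c₀ : ZMod 4 × ZMod 4 × ZMod 2) (hc : e ((IsCMField.complexConj K).restrictScalars ℚ) = c₀)
    (T₀ : Finset (ZMod 4 × ZMod 4 × ZMod 2))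
    (hcm : ∀ x : ZMod 4 × ZMod 4 × ZMod 2, x ∈ T₀ ↔
      (c₀.1 + x.1,
      c₀.2.1 + x.2.1,
      c₀.2.2 + x.2.2 + ((c₀.2.1.val * x.1.val : ℕ) : ZMod 2)) ∉ T₀)
    (hprim : ∀ v : ZMod 4 × ZMod 4 × ZMod 2, v ≠ 0 →
      ∃ w : ZMod 4 × ZMod 4 × ZMod 2, ¬ (w ∈ T₀ ↔
      (v.1 + w.1,
      v.2.1 + w.2.1,
      v.2.2 + w.2.2 + ((v.2.1.val * w.1.val : ℕ) : ZMod 2)) ∈ T₀))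
    (D : Finset (ZMod 4 × ZMod 4 × ZMod 2))
    (hbal : ∀ g : ZMod 4 × ZMod 4 × ZMod 2, 2 * (D.filter fun x =>
      (x.1 + g.1,
      x.2.1 + g.2.1,
      x.2.2 + g.2.2 + ((x.2.1.val * g.1.val : ℕ) : ZMod 2)) ∈ T₀).card = D.card)
    (hmov : ∃ x ∈ D,
      (c₀.1 + x.1,
      c₀.2.1 + x.2.1,
      c₀.2.2 + x.2.2 + ((c₀.2.1.val * x.1.val : ℕ) : ZMod 2)) ∉ D) :
    ∃ (Φ : CMType K) (φ₀ : K →+* ℂ) (A : AbelianVariety ℂ) (ι : 𝓞 K →+* End A)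
      (θ : K →+* Module.End ℂ (complexBetti A.X 1)),
      IsPrimitive (ℂ ≃+* ℂ) Φ.1 φ₀ ∧ ¬ IsNondegenerate Φ ∧ IsCMTypeRealisation Φ A ι θ ∧ A.IsSimple ∧ A.dim = 16 ∧
      ∃ m q : ℕ, ∃ x : complexBetti (⨁ fun _ : Fin m => A).X (2 * q), IsRationalClass x ∧
        IsOfHodgeType (⨁ fun _ : Fin m => A).dim (⨁ fun _ : Fin m => A).X (2 * q) q q x ∧
        x ∉ divisorClassesSpan (⨁ fun _ : Fin m => A).X (⨁ fun _ : Fin m => A).dim q := by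
  classical
  have hidem : ∀ x : ZMod 4 × ZMod 4 × ZMod 2,
      (x.1 + x.1,
      x.2.1 + x.2.1,
      x.2.2 + x.2.2 + ((x.2.1.val * x.1.val : ℕ) : ZMod 2)) = x →
      x = 0 := by
    decide
  have ho : e 1 = 0 := by
    have h := hmul 1 1
    rw [mul_one] at h
    exact hidem (e 1) h.symm
  have h := exists_simple_degenerate_of_table_balanced
    (fun x y : ZMod 4 × ZMod 4 × ZMod 2 =>
      (x.1 + y.1,
      x.2.1 + y.2.1,
      x.2.2 + y.2.2 + ((x.2.1.val * y.1.val : ℕ) : ZMod 2)))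
    e hmul c₀ hc _ ho T₀ hcm hprim D hbal hmov
  have hcard : Fintype.card (ZMod 4 × ZMod 4 × ZMod 2) / 2 = 16 := by
    simp [Fintype.card_prod, ZMod.card]
  rwa [hcard] at h

/-- **row #40 `⟨a,b | a⁴, b⁴, [a,b] = z⟩`, complex conjugation `(0, 0, 1)`: a simple DEGENERATE CM abelian `16`-fold with CM by
`K`** (primitive CM set of rank `13 < 17`, balanced-set certificate `|D| = 4`, by `decide`). [cite: Shimura1998, §6.2 Thm. 3
and §8.2 Prop. 26] [cite: Gordon1999HodgeAVSurvey, Thm. 6.4 and §9.3] -/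
theorem exists_simple_degenerate_c4c4z_conj_0_0_1 (e : (K ≃ₐ[ℚ] K) ≃ ZMod 4 × ZMod 4 × ZMod 2)
    (hmul : ∀ a b : K ≃ₐ[ℚ] K, e (a * b) =
      ((e a).1 + (e b).1,
      (e a).2.1 + (e b).2.1,
      (e a).2.2 + (e b).2.2 + (((e a).2.1.val * (e b).1.val : ℕ) : ZMod 2)))
    (hc : e ((IsCMField.complexConj K).restrictScalars ℚ) =
      ((0 : ZMod 4), (0 : ZMod 4), (1 : ZMod 2))) :
    ∃ (Φ : CMType K) (φ₀ : K →+* ℂ) (A : AbelianVariety ℂ) (ι : 𝓞 K →+* End A)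
      (θ : K →+* Module.End ℂ (complexBetti A.X 1)),
      IsPrimitive (ℂ ≃+* ℂ) Φ.1 φ₀ ∧ ¬ IsNondegenerate Φ ∧ IsCMTypeRealisation Φ A ι θ ∧ A.IsSimple ∧ A.dim = 16 ∧
      ∃ m q : ℕ, ∃ x : complexBetti (⨁ fun _ : Fin m => A).X (2 * q), IsRationalClass x ∧
        IsOfHodgeType (⨁ fun _ : Fin m => A).dim (⨁ fun _ : Fin m => A).X (2 * q) q q x ∧
        x ∉ divisorClassesSpan (⨁ fun _ : Fin m => A).X (⨁ fun _ : Fin m => A).dim q :=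
  exists_simple_degenerate_of_c4c4z_balanced e hmul _ hc
    {(0, 0, 1), (0, 1, 1), (0, 2, 1), (0, 3, 0), (1, 0, 1), (1, 1, 1), (1, 2, 1), (1, 3, 0), (2, 0, 1), (2, 1, 0),
    (2, 2, 1), (2, 3, 0), (3, 0, 1), (3, 1, 0), (3, 2, 0), (3, 3, 1)}
    (by decide) (by decide)
    {(0, 0, 0), (1, 3, 1), (2, 2, 1), (3, 1, 0)} (by decide) (by decide)

/-- **row #40 `⟨a,b | a⁴, b⁴, [a,b] = z⟩`, complex conjugation `(0, 2, 0)`: a simple DEGENERATE CM abelian `16`-fold with CM by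
`K`** (primitive CM set of rank `11 < 17`, balanced-set certificate `|D| = 4`, by `decide`). [cite: Shimura1998, §6.2 Thm. 3
and §8.2 Prop. 26] [cite: Gordon1999HodgeAVSurvey, Thm. 6.4 and §9.3] -/
theorem exists_simple_degenerate_c4c4z_conj_0_2_0 (e : (K ≃ₐ[ℚ] K) ≃ ZMod 4 × ZMod 4 × ZMod 2)
    (hmul : ∀ a b : K ≃ₐ[ℚ] K, e (a * b) =
      ((e a).1 + (e b).1,
      (e a).2.1 + (e b).2.1,
      (e a).2.2 + (e b).2.2 + (((e a).2.1.val * (e b).1.val : ℕ) : ZMod 2)))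
    (hc : e ((IsCMField.complexConj K).restrictScalars ℚ) =
      ((0 : ZMod 4), (2 : ZMod 4), (0 : ZMod 2))) :
    ∃ (Φ : CMType K) (φ₀ : K →+* ℂ) (A : AbelianVariety ℂ) (ι : 𝓞 K →+* End A)
      (θ : K →+* Module.End ℂ (complexBetti A.X 1)),
      IsPrimitive (ℂ ≃+* ℂ) Φ.1 φ₀ ∧ ¬ IsNondegenerate Φ ∧ IsCMTypeRealisation Φ A ι θ ∧ A.IsSimple ∧ A.dim = 16 ∧
      ∃ m q : ℕ, ∃ x : complexBetti (⨁ fun _ : Fin m => A).X (2 * q), IsRationalClass x ∧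
        IsOfHodgeType (⨁ fun _ : Fin m => A).dim (⨁ fun _ : Fin m => A).X (2 * q) q q x ∧
        x ∉ divisorClassesSpan (⨁ fun _ : Fin m => A).X (⨁ fun _ : Fin m => A).dim q :=
  exists_simple_degenerate_of_c4c4z_balanced e hmul _ hc
    {(0, 0, 0), (0, 0, 1), (0, 1, 0), (0, 3, 1), (1, 0, 1), (1, 1, 0), (1, 2, 0), (1, 3, 1), (2, 1, 0), (2, 2, 0),
    (2, 2, 1), (2, 3, 1), (3, 0, 1), (3, 1, 1), (3, 2, 0), (3, 3, 0)}
    (by decide) (by decide)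
    {(0, 0, 0), (0, 0, 1), (2, 0, 0), (2, 0, 1)} (by decide) (by decide)

/-- **row #40 `⟨a,b | a⁴, b⁴, [a,b] = z⟩`, complex conjugation `(0, 2, 1)`: a simple DEGENERATE CM abelian `16`-fold with CM by
`K`** (primitive CM set of rank `15 < 17`, balanced-set certificate `|D| = 8`, by `decide`). [cite: Shimura1998, §6.2 Thm. 3
and §8.2 Prop. 26] [cite: Gordon1999HodgeAVSurvey, Thm. 6.4 and §9.3] -/
theorem exists_simple_degenerate_c4c4z_conj_0_2_1 (e : (K ≃ₐ[ℚ] K) ≃ ZMod 4 × ZMod 4 × ZMod 2)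
    (hmul : ∀ a b : K ≃ₐ[ℚ] K, e (a * b) =
      ((e a).1 + (e b).1,
      (e a).2.1 + (e b).2.1,
      (e a).2.2 + (e b).2.2 + (((e a).2.1.val * (e b).1.val : ℕ) : ZMod 2)))
    (hc : e ((IsCMField.complexConj K).restrictScalars ℚ) =
      ((0 : ZMod 4), (2 : ZMod 4), (1 : ZMod 2))) :
    ∃ (Φ : CMType K) (φ₀ : K →+* ℂ) (A : AbelianVariety ℂ) (ι : 𝓞 K →+* End A)
      (θ : K →+* Module.End ℂ (complexBetti A.X 1)),
      IsPrimitive (ℂ ≃+* ℂ) Φ.1 φ₀ ∧ ¬ IsNondegenerate Φ ∧ IsCMTypeRealisation Φ A ι θ ∧ A.IsSimple ∧ A.dim = 16 ∧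
      ∃ m q : ℕ, ∃ x : complexBetti (⨁ fun _ : Fin m => A).X (2 * q), IsRationalClass x ∧
        IsOfHodgeType (⨁ fun _ : Fin m => A).dim (⨁ fun _ : Fin m => A).X (2 * q) q q x ∧
        x ∉ divisorClassesSpan (⨁ fun _ : Fin m => A).X (⨁ fun _ : Fin m => A).dim q :=
  exists_simple_degenerate_of_c4c4z_balanced e hmul _ hc
    {(0, 0, 1), (0, 1, 0), (0, 1, 1), (0, 2, 1), (1, 1, 1), (1, 2, 0), (1, 2, 1), (1, 3, 1), (2, 1, 0), (2, 2, 0),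
    (2, 2, 1), (2, 3, 0), (3, 0, 0), (3, 0, 1), (3, 1, 0), (3, 3, 0)}
    (by decide) (by decide)
    {(0, 0, 0), (0, 1, 0), (0, 2, 0), (0, 3, 0), (2, 0, 0), (2, 1, 0), (2, 2, 0), (2, 3, 0)} (by decide) (by decide)

/-- **row #40 `⟨a,b | a⁴, b⁴, [a,b] = z⟩`, complex conjugation `(2, 0, 0)`: a simple DEGENERATE CM abelian `16`-fold with CM by
`K`** (primitive CM set of rank `15 < 17`, balanced-set certificate `|D| = 8`, by `decide`). [cite: Shimura1998, §6.2 Thm. 3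
and §8.2 Prop. 26] [cite: Gordon1999HodgeAVSurvey, Thm. 6.4 and §9.3] -/
theorem exists_simple_degenerate_c4c4z_conj_2_0_0 (e : (K ≃ₐ[ℚ] K) ≃ ZMod 4 × ZMod 4 × ZMod 2)
    (hmul : ∀ a b : K ≃ₐ[ℚ] K, e (a * b) =
      ((e a).1 + (e b).1,
      (e a).2.1 + (e b).2.1,
      (e a).2.2 + (e b).2.2 + (((e a).2.1.val * (e b).1.val : ℕ) : ZMod 2)))
    (hc : e ((IsCMField.complexConj K).restrictScalars ℚ) =
      ((2 : ZMod 4), (0 : ZMod 4), (0 : ZMod 2))) :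
    ∃ (Φ : CMType K) (φ₀ : K →+* ℂ) (A : AbelianVariety ℂ) (ι : 𝓞 K →+* End A)
      (θ : K →+* Module.End ℂ (complexBetti A.X 1)),
      IsPrimitive (ℂ ≃+* ℂ) Φ.1 φ₀ ∧ ¬ IsNondegenerate Φ ∧ IsCMTypeRealisation Φ A ι θ ∧ A.IsSimple ∧ A.dim = 16 ∧
      ∃ m q : ℕ, ∃ x : complexBetti (⨁ fun _ : Fin m => A).X (2 * q), IsRationalClass x ∧
        IsOfHodgeType (⨁ fun _ : Fin m => A).dim (⨁ fun _ : Fin m => A).X (2 * q) q q x ∧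
        x ∉ divisorClassesSpan (⨁ fun _ : Fin m => A).X (⨁ fun _ : Fin m => A).dim q :=
  exists_simple_degenerate_of_c4c4z_balanced e hmul _ hc
    {(0, 0, 0), (0, 0, 1), (0, 1, 1), (0, 2, 1), (1, 0, 0), (1, 0, 1), (1, 1, 0), (1, 1, 1), (1, 2, 1), (1, 3, 0),
    (2, 1, 0), (2, 2, 0), (2, 3, 0), (2, 3, 1), (3, 2, 0), (3, 3, 1)}
    (by decide) (by decide)
    {(0, 0, 0), (0, 1, 1), (0, 2, 0), (0, 3, 1), (2, 0, 1), (2, 1, 0), (2, 2, 1), (2, 3, 0)} (by decide) (by decide)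

/-- **row #40 `⟨a,b | a⁴, b⁴, [a,b] = z⟩`, complex conjugation `(2, 0, 1)`: a simple DEGENERATE CM abelian `16`-fold with CM by
`K`** (primitive CM set of rank `15 < 17`, balanced-set certificate `|D| = 8`, by `decide`). [cite: Shimura1998, §6.2 Thm. 3
and §8.2 Prop. 26] [cite: Gordon1999HodgeAVSurvey, Thm. 6.4 and §9.3] -/
theorem exists_simple_degenerate_c4c4z_conj_2_0_1 (e : (K ≃ₐ[ℚ] K) ≃ ZMod 4 × ZMod 4 × ZMod 2)
    (hmul : ∀ a b : K ≃ₐ[ℚ] K, e (a * b) =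
      ((e a).1 + (e b).1,
      (e a).2.1 + (e b).2.1,
      (e a).2.2 + (e b).2.2 + (((e a).2.1.val * (e b).1.val : ℕ) : ZMod 2)))
    (hc : e ((IsCMField.complexConj K).restrictScalars ℚ) =
      ((2 : ZMod 4), (0 : ZMod 4), (1 : ZMod 2))) :
    ∃ (Φ : CMType K) (φ₀ : K →+* ℂ) (A : AbelianVariety ℂ) (ι : 𝓞 K →+* End A)
      (θ : K →+* Module.End ℂ (complexBetti A.X 1)),
      IsPrimitive (ℂ ≃+* ℂ) Φ.1 φ₀ ∧ ¬ IsNondegenerate Φ ∧ IsCMTypeRealisation Φ A ι θ ∧ A.IsSimple ∧ A.dim = 16 ∧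
      ∃ m q : ℕ, ∃ x : complexBetti (⨁ fun _ : Fin m => A).X (2 * q), IsRationalClass x ∧
        IsOfHodgeType (⨁ fun _ : Fin m => A).dim (⨁ fun _ : Fin m => A).X (2 * q) q q x ∧
        x ∉ divisorClassesSpan (⨁ fun _ : Fin m => A).X (⨁ fun _ : Fin m => A).dim q :=
  exists_simple_degenerate_of_c4c4z_balanced e hmul _ hc
    {(0, 0, 1), (0, 2, 0), (0, 3, 0), (1, 1, 0), (1, 1, 1), (1, 3, 0), (2, 0, 1), (2, 1, 0), (2, 1, 1), (2, 2, 0),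
    (2, 3, 0), (3, 0, 0), (3, 0, 1), (3, 2, 0), (3, 2, 1), (3, 3, 0)}
    (by decide) (by decide)
    {(0, 0, 0), (0, 2, 0), (1, 0, 1), (1, 2, 1), (2, 0, 0), (2, 2, 0), (3, 0, 1), (3, 2, 1)} (by decide) (by decide)

/-- **row #40 `⟨a,b | a⁴, b⁴, [a,b] = z⟩`, complex conjugation `(2, 2, 0)`: a simple DEGENERATE CM abelian `16`-fold with CM by
`K`** (primitive CM set of rank `15 < 17`, balanced-set certificate `|D| = 8`, by `decide`). [cite: Shimura1998, §6.2 Thm. 3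
and §8.2 Prop. 26] [cite: Gordon1999HodgeAVSurvey, Thm. 6.4 and §9.3] -/
theorem exists_simple_degenerate_c4c4z_conj_2_2_0 (e : (K ≃ₐ[ℚ] K) ≃ ZMod 4 × ZMod 4 × ZMod 2)
    (hmul : ∀ a b : K ≃ₐ[ℚ] K, e (a * b) =
      ((e a).1 + (e b).1,
      (e a).2.1 + (e b).2.1,
      (e a).2.2 + (e b).2.2 + (((e a).2.1.val * (e b).1.val : ℕ) : ZMod 2)))
    (hc : e ((IsCMField.complexConj K).restrictScalars ℚ) =
      ((2 : ZMod 4), (2 : ZMod 4), (0 : ZMod 2))) :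
    ∃ (Φ : CMType K) (φ₀ : K →+* ℂ) (A : AbelianVariety ℂ) (ι : 𝓞 K →+* End A)
      (θ : K →+* Module.End ℂ (complexBetti A.X 1)),
      IsPrimitive (ℂ ≃+* ℂ) Φ.1 φ₀ ∧ ¬ IsNondegenerate Φ ∧ IsCMTypeRealisation Φ A ι θ ∧ A.IsSimple ∧ A.dim = 16 ∧
      ∃ m q : ℕ, ∃ x : complexBetti (⨁ fun _ : Fin m => A).X (2 * q), IsRationalClass x ∧
        IsOfHodgeType (⨁ fun _ : Fin m => A).dim (⨁ fun _ : Fin m => A).X (2 * q) q q x ∧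
        x ∉ divisorClassesSpan (⨁ fun _ : Fin m => A).X (⨁ fun _ : Fin m => A).dim q :=
  exists_simple_degenerate_of_c4c4z_balanced e hmul _ hc
    {(0, 0, 0), (0, 0, 1), (0, 1, 0), (0, 1, 1), (0, 3, 1), (1, 0, 1), (1, 1, 0), (1, 2, 1), (2, 0, 0), (2, 0, 1),
    (2, 1, 0), (3, 0, 0), (3, 1, 0), (3, 1, 1), (3, 2, 0), (3, 3, 1)}
    (by decide) (by decide)
    {(0, 0, 0), (0, 2, 1), (1, 0, 1), (1, 2, 0), (2, 0, 0), (2, 2, 1), (3, 0, 1), (3, 2, 0)} (by decide) (by decide)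

/-- **row #40 `⟨a,b | a⁴, b⁴, [a,b] = z⟩`, complex conjugation `(2, 2, 1)`: a simple DEGENERATE CM abelian `16`-fold with CM by
`K`** (primitive CM set of rank `13 < 17`, balanced-set certificate `|D| = 4`, by `decide`). [cite: Shimura1998, §6.2 Thm. 3
and §8.2 Prop. 26] [cite: Gordon1999HodgeAVSurvey, Thm. 6.4 and §9.3] -/
theorem exists_simple_degenerate_c4c4z_conj_2_2_1 (e : (K ≃ₐ[ℚ] K) ≃ ZMod 4 × ZMod 4 × ZMod 2)
    (hmul : ∀ a b : K ≃ₐ[ℚ] K, e (a * b) =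
      ((e a).1 + (e b).1,
      (e a).2.1 + (e b).2.1,
      (e a).2.2 + (e b).2.2 + (((e a).2.1.val * (e b).1.val : ℕ) : ZMod 2)))
    (hc : e ((IsCMField.complexConj K).restrictScalars ℚ) =
      ((2 : ZMod 4), (2 : ZMod 4), (1 : ZMod 2))) :
    ∃ (Φ : CMType K) (φ₀ : K →+* ℂ) (A : AbelianVariety ℂ) (ι : 𝓞 K →+* End A)
      (θ : K →+* Module.End ℂ (complexBetti A.X 1)),
      IsPrimitive (ℂ ≃+* ℂ) Φ.1 φ₀ ∧ ¬ IsNondegenerate Φ ∧ IsCMTypeRealisation Φ A ι θ ∧ A.IsSimple ∧ A.dim = 16 ∧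
      ∃ m q : ℕ, ∃ x : complexBetti (⨁ fun _ : Fin m => A).X (2 * q), IsRationalClass x ∧
        IsOfHodgeType (⨁ fun _ : Fin m => A).dim (⨁ fun _ : Fin m => A).X (2 * q) q q x ∧
        x ∉ divisorClassesSpan (⨁ fun _ : Fin m => A).X (⨁ fun _ : Fin m => A).dim q :=
  exists_simple_degenerate_of_c4c4z_balanced e hmul _ hc
    {(0, 0, 0), (0, 1, 1), (0, 2, 1), (0, 3, 1), (1, 1, 1), (1, 3, 0), (2, 0, 1), (2, 1, 1), (2, 2, 0), (2, 3, 1),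
    (3, 0, 0), (3, 0, 1), (3, 1, 0), (3, 2, 0), (3, 2, 1), (3, 3, 1)}
    (by decide) (by decide)
    {(0, 0, 0), (0, 0, 1), (2, 0, 0), (2, 0, 1)} (by decide) (by decide)

end Summit.HodgeConjecture.CorCM.GaloisModels

end
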